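import Summits.HubbardSuperconductivity.HubbardSuperconductivity.Theorems.AnisotropyChordTransferFibre3FinX3Eval

/-!
# Route `AnisotropyChord` / H0 rotor rung: FIN per-`L` GM₃ (X5), `L = 30` — rows `N₁` / D / side-condition cell facts, part `p61`

Kernel facts (`decide +kernel`) for cert cells 142, 143 of the per-`L` grid of `L = 30`: `xbnCellAny2` (row `N₁` on XB2 point wedges recomputed in the kernel, exporting the literal brackets `nt ⊇ T⁺ − 3λ₂` and `tb ⊇ T⁺·D`), `xdCellAnyN0` (row D, reads `nt`), `sdCellAnyZN` (side condition, reads `nt`); evaluators `…FinX3Eval` / `…FinX5Eval`; constants from the compiled design probe (x3probe/x3plan, margins c ×0.985, b ×1.03, aD ×1.03); assembled in `…FinX5GM3Thirty`.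
Prover seat `hubbard-h0-rotor-p3` g8; helper for piece A = stmt-HubbardSuperconductivity-23918 of rung 19089 (`--supports`, helper class).
WHAT THIS IS NOT: nothing here proves superconductivity in the Hubbard model (rotor TARGET as worded stays FALSE, g15 verdict); kernel facts for the FIN certificate of ONE conditional reduction.  Tree imports only; zero data; standard axioms.
-/

set_option linter.dupNamespace false
set_option autoImplicit false

namespace Summit.HubbardSuperconductivity.HubbardSuperconductivity.Theorems.AnisotropyChord.Transfer.Fibre3

namespace FinXD

open FinXB FinCell Hole2

set_option maxHeartbeats 4000000 in
/-- row `N₁` of cell 142 of `L = 30` (`c = 11/20`), exporting `nt`, `tb`. [folklore] -/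
theorem xn30_142 : xbnCellAny2 30 (49/50 : ℚ) 1930637385772892 1978903320417215 (11/20 : ℚ) ((61291668971369 : ℤ), (92932447664091 : ℤ)) ((5853168475263694 : ℤ), (6029677759942087 : ℤ)) = true := by decide +kernel

set_option maxHeartbeats 4000000 in
/-- row D of cell 142 of `L = 30` (`aD = 19/250`). [folklore] -/
theorem xd30_142 : xdCellAnyN0 30 (49/50 : ℚ) 1930637385772892 1978903320417215 (19/250 : ℚ) ((61291668971369 : ℤ), (92932447664091 : ℤ)) = true := by decide +kernel

set_option maxHeartbeats 4000000 in
/-- side condition of cell 142 of `L = 30` (`c, b = 148/100, aD`). [folklore] -/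
theorem sd30_142 : sdCellAnyZN 30 (49/50 : ℚ) 100 1930637385772892 1978903320417215 ((11/20 : ℚ), (148 : ℕ), (19/250 : ℚ)) ((61291668971369 : ℤ), (92932447664091 : ℤ)) = true := by decide +kernel

set_option maxHeartbeats 4000000 in
/-- row `N₁` of cell 143 of `L = 30` (`c = 11/20`), exporting `nt`, `tb`. [folklore] -/
theorem xn30_143 : xbnCellAny2 30 (49/50 : ℚ) 1978903320417215 2028375903427646 (11/20 : ℚ) ((65328313816256 : ℤ), (99583255099726 : ℤ)) ((6002002040265891 : ℤ), (6184747200184674 : ℤ)) = true := by decide +kernel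

set_option maxHeartbeats 4000000 in
/-- row D of cell 143 of `L = 30` (`aD = 19/250`). [folklore] -/
theorem xd30_143 : xdCellAnyN0 30 (49/50 : ℚ) 1978903320417215 2028375903427646 (19/250 : ℚ) ((65328313816256 : ℤ), (99583255099726 : ℤ)) = true := by decide +kernel

set_option maxHeartbeats 4000000 in
/-- side condition of cell 143 of `L = 30` (`c, b = 152/100, aD`). [folklore] -/
theorem sd30_143 : sdCellAnyZN 30 (49/50 : ℚ) 100 1978903320417215 2028375903427646 ((11/20 : ℚ), (152 : ℕ), (19/250 : ℚ)) ((65328313816256 : ℤ), (99583255099726 : ℤ)) = true := by decide +kernel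

end FinXD

end Summit.HubbardSuperconductivity.HubbardSuperconductivity.Theorems.AnisotropyChord.Transfer.Fibre3
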